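import Summits.HodgeConjecture.HodgeConjecture.Theorems.Ring2AbelianAllFrameSpreading
import Summits.HodgeConjecture.HodgeConjecture.Theorems.Ring2AbelianAllSpreadDomination
import HarnessLib

/-!
# Ring 2 · sub-cell AbelianAll, SPREAD axis, part III — two additions to the LEAD's frame table
# (`Ring2AbelianAllFrameSpreading` §B): the `CMIdle` bit of the brief's example `S_ZD` (it is CM-idle, part II),
# and the finite-strata node H4 of deform II placed in the grammar

HONEST FRAMING (page 1, verbatim): **research route, not a corollary; conditional on HC_CM plus one named
minimal statement.** Cell line: research route conditional on HC_CM; not a corollary; Q11.4-sentence-2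
already refuted in dim ≥ 3. Nothing below proves `HC_CM`, `HC_AV` or the item `CMToAbelian`
(stmt-HodgeConjecture-16267); every OPEN node is an `@[conjecture]` def used as a HYPOTHESIS; the printed inputs
enter as BINDERS: `hF : deligne1982_cmDenseMumfordTateFamilies` (fact #20, Deligne LNM 900 Prop. 6.1, a refereed
Literature fact taken as a hypothesis) and `h𝔄 : Andre1992_hodgeClasses_cmAbelianVariety_mem_span_pullback_weilClasses`
(André 1992); `HC_CM` = `Theses.RankFourFaces.CMAbelianHodge` is a binder only. Seat `pub-hodge-ring2-ab-spread-1`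
(planner-pub-hodge-ring2-ab-spread-1-0), gen 1, part III (parts I/II: `Ring2AbelianAllSpread`,
`Ring2AbelianAllSpreadDomination`; the rows `ClosesWithCM` / `OnPathAV` / `ExactWithCM` of S_ZD, U_Z, U are the
LEAD's `closesWithCM_spreadAxis` / `onPathAV_spreadAxis` / `exactWithCM_spreadAxis` and are NOT repeated here).

## What changes in the LEAD's table (`Ring2AbelianAllFrameSpreading`, Mumford–Tate-family branch)

| node | `ClosesWithCM` | `OnPathAV` | `CMIdle` (kernel) | owner |
|---|---|---|---|---|
| S_ZD `SpreadFromZariskiDenseCMPoints` (the brief's example sentence) | mod `hF` (LEAD) | yes (LEAD) | **was "not known"; now: YES mod `hF`, `h𝔄` and the two densely-anchored-family inputs `DA_q`, `DA_K`** (`cmIdle_spreadZD`, from part II `HC_AV_of_denselyAnchored_of_spreadZD`) | spread-1 |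
| U_Z, U | mod `hF` (LEAD) | yes (LEAD) | not known — and not expected: premise at ALL CM fibres | spread-1 / deform |
| H4 `Ring2.Deform.AlgebraicityLocusClosedOnCMDenseFamilies` (finite-strata face of U; NEW ROW) | mod `hF` | yes | not known | deform II, placed here |

So in the KIND column (RING2-MAP AB.F3: headline = CHAIN + KIND, never "minimal" absolutely) the Mumford–Tate branch
splits exactly like the pencil branch: the SOME-anchors node S_ZD is of the kind "contains `HC_CM`" (granted typed,
on-path inputs), the ALL-CM-fibres nodes U_Z, U, H4 are of the kind "complementary to `HC_CM`". `DA_q` / `DA_K`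
(`DenselyAnchoredWeilFamilies{ImaginaryQuadratic,CMField}`, part II) are typed-only `@[conjecture]` inputs abstracted
from Deligne's proof of LNM 900 Thm. 4.8 (pp. 50–51: the family contains `A₀ ⊗ E` for EVERY `d/2`-dimensional `A₀`,
where the Weil classes are algebraic) and André 1996 Lemme 6.3.3 (elliptic-power fibre, `B = D` by [KuM91]); the CM
choice of the anchors and their density (Hecke orbit, real approximation) is OUR inference, not print — hence
hypotheses, on-path from `HC_AV` mod `hF` (part II), never facts. By antitonicity every node above S_ZD is CM-idle
under the same inputs (`cmIdle_abelianSchemeVHC_of_denselyAnchored`: a second kernel path to deform (D)'s "VHC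
dominates `HC_CM`", through Zariski-dense anchors instead of Lemmes 6.3.2–6.3.3). OPEN and claimed nowhere:
`CMIdle U`, `CMIdle U_Z`, `CMIdle H4`, and the converses `U ⟹ U_Z` (without AO⁺), `U_Z ⟹ S_ZD`, `U ⟹ H4`.

References (bib keys): Deligne1982HodgeCycles (Prop. 6.1; Thm. 4.8 proof pp. 50–51); Andre1992HodgeCM;
Andre1996Motifs (Lemme 6.3.3 pp. 32–33); CattaniDeligneKaplan1995 (Thm. 1.1); PlatonovRapinchuk1994 (Thm. 7.7).
-/

set_option linter.dupNamespace false

namespace Summit.HodgeConjecture.HodgeConjecture.Ring2.AbelianAll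

open Literature.AlgebraicGeometry Literature.AlgebraicGeometry.Motives
open Literature.AlgebraicGeometry.HodgeTheory
open Literature.AlgebraicGeometry.Deligne1982 (deligne1982_cmDenseMumfordTateFamilies)
open Summit.HodgeConjecture.HodgeConjecture
open Summit.HodgeConjecture.HodgeConjecture.Theses
open Summit.HodgeConjecture.HodgeConjecture.Theses.RankFourFaces (CMAbelianHodge CMToAbelian)
open Summit.HodgeConjecture.HodgeConjecture.Theses.PadicSemiregularLift (HodgeAbelianVarieties)
open Summit.HodgeConjecture.HodgeConjecture.Ring2.Deform (UniformAlgebraicityAtCMPoints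
  AlgebraicityLocusClosedOnCMDenseFamilies)
open Summit.HodgeConjecture.HodgeConjecture.Ring2.Hypotheses (AbelianSchemeVHC)

/-! ## §1 The `CMIdle` bit of the brief's example -/

/-- **`CMIdle S_ZD`**, mod `hF`, André 1992 and the two densely-anchored Weil-family inputs: next to the brief's
example sentence the hypothesis `HC_CM` is decorative (REFEREE-AB F-ab-3 honesty in kernel form; the LEAD's table
entry "S_ZD · CMIdle: not known" becomes "yes, mod these inputs"). [cite: Deligne1982HodgeCycles, Thm. 4.8 (pp. 50–51)]
[cite: Andre1992HodgeCM] -/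
theorem cmIdle_spreadZD (hF : deligne1982_cmDenseMumfordTateFamilies)
    (h𝔄 : Andre1992_hodgeClasses_cmAbelianVariety_mem_span_pullback_weilClasses)
    (hDq : DenselyAnchoredWeilFamiliesImaginaryQuadratic) (hDcm : DenselyAnchoredWeilFamiliesCMField) :
    CMIdle SpreadFromZariskiDenseCMPoints :=
  fun hS ↦ HC_AV_of_denselyAnchored_of_spreadZD hF h𝔄 hDq hDcm hS

/-- Hence `CMIdle` for every node ABOVE S_ZD, e.g. (1) `AbelianSchemeVHC` — through Zariski-dense anchors, not
through Lemmes 6.3.2–6.3.3 (compare `Ring2.Deform.HC_CM_of_andre1996_of_abelianSchemeVHC`). [folklore] -/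
theorem cmIdle_abelianSchemeVHC_of_denselyAnchored (hF : deligne1982_cmDenseMumfordTateFamilies)
    (h𝔄 : Andre1992_hodgeClasses_cmAbelianVariety_mem_span_pullback_weilClasses)
    (hDq : DenselyAnchoredWeilFamiliesImaginaryQuadratic) (hDcm : DenselyAnchoredWeilFamiliesCMField) :
    CMIdle AbelianSchemeVHC :=
  cmIdle_antitone spreadFromZariskiDenseCMPoints_of_abelianSchemeVHC (cmIdle_spreadZD hF h𝔄 hDq hDcm)

/-- The KIND split of the Mumford–Tate branch in one line: granted the inputs, `S_ZD ↔ HC_AV` outright (no `HC_CM`),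
while for U the tree has only `HC_AV ↔ HC_CM ∧ U`. [folklore] -/
theorem spreadZD_iff_HC_AV_and_uniform_exact (hF : deligne1982_cmDenseMumfordTateFamilies)
    (h𝔄 : Andre1992_hodgeClasses_cmAbelianVariety_mem_span_pullback_weilClasses)
    (hDq : DenselyAnchoredWeilFamiliesImaginaryQuadratic) (hDcm : DenselyAnchoredWeilFamiliesCMField) :
    (SpreadFromZariskiDenseCMPoints ↔ HodgeAbelianVarieties) ∧
      (HodgeAbelianVarieties ↔ (CMAbelianHodge ∧ UniformAlgebraicityAtCMPoints)) :=
  ⟨⟨cmIdle_spreadZD hF h𝔄 hDq hDcm, onPathAV_spreadAxis.1⟩, (exactWithCM_spreadAxis hF).2.2⟩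

/-- Relativised to `HC_CM`, S_ZD too IS the item: `ModCM S_ZD ↔ CMToAbelian`, mod `hF` (the LEAD has the U
instance `modCM_uniform_iff_cmToAbelian`). [folklore] -/
theorem modCM_spreadZD_iff_cmToAbelian (hF : deligne1982_cmDenseMumfordTateFamilies) :
    ModCM SpreadFromZariskiDenseCMPoints ↔ CMToAbelian :=
  modCM_iff_cmToAbelian_of_exactWithCM (exactWithCM_spreadAxis hF).1

/-! ## §2 The finite-strata node H4 of deform II in the grammar (new row) -/

/-- H4 is on-path. [folklore] -/
theorem onPathAV_locusClosed : OnPathAV AlgebraicityLocusClosedOnCMDenseFamilies :=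
  Deform.algebraicityLocusClosedOnCMDenseFamilies_of_HC_AV

/-- H4 closes with `HC_CM`, mod `hF` (through `H4 ⟹ U` and the LEAD's U row). [cite: Deligne1982HodgeCycles, Prop. 6.1] -/
theorem closesWithCM_locusClosed_of_deligne1982 (hF : deligne1982_cmDenseMumfordTateFamilies) :
    ClosesWithCM AlgebraicityLocusClosedOnCMDenseFamilies :=
  closesWithCM_antitone Deform.uniformAlgebraicityAtCMPoints_of_locusClosed (closesWithCM_spreadAxis hF).2.2

/-- H4 is an exact complement of `HC_CM`, mod `hF`; relativised it is the item. [folklore] -/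
theorem exactWithCM_locusClosed_of_deligne1982 (hF : deligne1982_cmDenseMumfordTateFamilies) :
    ExactWithCM AlgebraicityLocusClosedOnCMDenseFamilies ∧
      (ModCM AlgebraicityLocusClosedOnCMDenseFamilies ↔ CMToAbelian) :=
  have h := exactWithCM_iff.2 ⟨closesWithCM_locusClosed_of_deligne1982 hF, onPathAV_locusClosed⟩
  ⟨h, modCM_iff_cmToAbelian_of_exactWithCM h⟩

/-- Under `HC_CM` (mod `hF`), H4 coincides with U, U_Z, S_ZD (all are `HC_AV`); WITHOUT `HC_CM` only `H4 ⟹ U` is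
in the tree. [folklore] -/
theorem locusClosed_collapse_of_HC_CM (hF : deligne1982_cmDenseMumfordTateFamilies) (hCM : CMAbelianHodge) :
    (AlgebraicityLocusClosedOnCMDenseFamilies ↔ UniformAlgebraicityAtCMPoints) ∧
      (AlgebraicityLocusClosedOnCMDenseFamilies ↔ SpreadFromZariskiDenseCMLocus) ∧
      (AlgebraicityLocusClosedOnCMDenseFamilies ↔ SpreadFromZariskiDenseCMPoints) :=
  have h4 := (exactWithCM_locusClosed_of_deligne1982 hF).1
  have hs := exactWithCM_spreadAxis hF
  ⟨iff_of_exactWithCM_of_HC_CM h4 hs.2.2 hCM, iff_of_exactWithCM_of_HC_CM h4 hs.2.1 hCM,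
    iff_of_exactWithCM_of_HC_CM h4 hs.1 hCM⟩

/-! ## Audit: the inputs of §1 and the node of §2 are on-path from the summit (mod `hF`) -/

/-- From the Hodge conjecture: H4, and (mod `hF`) `DA_q`, `DA_K`. AO⁺ (`ZariskiDenseCMLocusIsDense`) is NOT claimed
on-path — it is an André–Oort-shaped statement about CM loci, independent of HC. [folklore] -/
theorem idleInputs_of_hodgeConjecture (hF : deligne1982_cmDenseMumfordTateFamilies) (hHC : _root_.HodgeConjecture) :
    AlgebraicityLocusClosedOnCMDenseFamilies ∧ DenselyAnchoredWeilFamiliesImaginaryQuadratic ∧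
      DenselyAnchoredWeilFamiliesCMField :=
  have hAV : HodgeAbelianVarieties := Deform.HC_AV_of_hodgeConjecture hHC
  ⟨onPathAV_locusClosed hAV, denselyAnchoredWeilFamiliesImaginaryQuadratic_of_deligne1982_of_HC_AV hF hAV,
    denselyAnchoredWeilFamiliesCMField_of_deligne1982_of_HC_AV hF hAV⟩

end Summit.HodgeConjecture.HodgeConjecture.Ring2.AbelianAll
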